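import Mathlib

/-!
# The 94-type table of the abstract `(4,3)` programme — definitions
(lane prim-rate, constants-miner 1, gen 27; census/g18–g19 `dtypes.py`, CLEAN-CERTIFICATES.md, CONVEX-BOOTSTRAP.md)

Support file for the closed crux `NoHeavyLowerTail` (stmt-CriticalPhenomena-4575), majority-gluing line.  The lane's
«abstract `(4,3)` programme» lives on the finite set of DETERMINISTIC BOUNDARY TYPES of the hub gadget: five marked
points (`0` = the hub `a`, `1..4` = the relays `v₁..v₄`), a set partition `π` of the relays into off-hub blocks, and
for each block a flag «cut» (not attached to the hub) / «attached».  There are `94` such types (`15` partitions,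
`2^{#blocks}` flag patterns each); every functional of the programme is multilinear in the block hub-weights, so a
general law is a mixture of these.  The Python module `census/g19/dtypes.py` tabulated the types and all functionals;
this file GENERATES the same table inside Lean (`allTypes`) and defines, as computable functions on it:

* the objective integrand `e = f − cut₁` (`f = 1[N ≥ 3]`, `N` = number of cut relays), the budgets `B_x = cut_x − cut₁`,
  the vdBHK rows `Calone_x, Cnotfull_x, CaloneY_x_y, Cnotalone_x, Cpair_xy, Ctriple`, the order rows `O_…_xy`;
* the isolation indicators `u_S` (pairwise separation in the five-point partition `σ`) and supports `ρ_t^S`;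
* the events `T_z` (only `v_z` attached), `S_z` (`{v_z}` a singleton cut block), all-cut, the hub-pair events `C_g`,
  the glued-pair events `P_g`, `G_g`, and the four events `A_j ⊇ D_j`, `C_j ⊇ B_j` of the relay-root van den Berg–Kahn rows;
* `combo` (integer certificates = reduced costs), and for LAWS `x : DType → ℝ` the linear functional `lin φ x = Σ_τ φ(τ)x_τ`
  with the abbreviations `E`, `uS`, `Tm`, `Sm`, `Cm`, `Pm`, `ACm`.

The typewise facts (counts, LEMMA B, the set facts of THEOREM CC, the reduced costs `rc ≤ 0` of the clean certificates,
all by `decide`) and the law-level bounds (THEOREM CC instances USTAR/QS1/EIGHTH/MIX/STAR/R207) are the business of the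
companion files `…MajorityGluingTypeTableFacts` / `…MajorityGluingTypeTableCertificates` of the same gen.  An independent Python replication of exactly this encoding reproduces
`dtypes.json` feature-for-feature (147 functionals × 94 types; lane record CANDIDATES §GEN-27).  Definitions only;
no percolation, no sorries.  [cite: VandenbergHaggstromKahn2005, Thm. 1.3 (p. 6)]
-/

namespace Summit.CriticalPhenomena.PercolationContinuityZ3.Theorems

namespace HubOnly
namespace TypeTable

/-! ### The deterministic types -/

/-- A deterministic boundary type of the hub gadget: `l2 l3 l4` are the block labels of the relays `v₂ v₃ v₄`
(restricted-growth labelling of the set partition `π` of `{v₁,v₂,v₃,v₄}`; `v₁` has label `0`), and `c0..c3` says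
whether the block with that label is CUT (`true`) or attached to the hub (`false`; unused labels carry `false`). -/
structure DType where
  /-- block label of `v₂` -/
  l2 : ℕ
  /-- block label of `v₃` -/
  l3 : ℕ
  /-- block label of `v₄` -/
  l4 : ℕ
  /-- block `0` (the block of `v₁`) is cut -/
  c0 : Bool
  /-- block `1` is cut -/
  c1 : Bool
  /-- block `2` is cut -/
  c2 : Bool
  /-- block `3` is cut -/
  c3 : Bool
deriving DecidableEq, Repr

/-- `[false]` or `[false, true]`: the admissible cut flags of an unused / used block label. -/
def flags (used : Bool) : List Bool := if used then [false, true] else [false]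

/-- The 15 restricted-growth label strings `(l2, l3, l4)` (`l1 = 0`, `l_{i+1} ≤ 1 + max`): the set partitions of the
four relays. -/
def labelStrings : List (ℕ × ℕ × ℕ) :=
  (List.range 2).flatMap fun a =>
    (List.range (a + 2)).flatMap fun b =>
      (List.range (max a b + 2)).map fun c => (a, b, c)

/-- THE TABLE: all 94 deterministic types (every label string, every cut pattern of its blocks). -/
def allTypes : List DType :=
  labelStrings.flatMap fun abc =>
    let nb := max abc.1 (max abc.2.1 abc.2.2) + 1
    (flags true).flatMap fun x0 =>
      (flags (decide (1 < nb))).flatMap fun x1 =>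
        (flags (decide (2 < nb))).flatMap fun x2 =>
          (flags (decide (3 < nb))).map fun x3 => ⟨abc.1, abc.2.1, abc.2.2, x0, x1, x2, x3⟩

namespace DType

variable (τ : DType)

/-- Block label of relay `x ∈ {1,2,3,4}` (`0` for `v₁`). -/
def lab : ℕ → ℕ
  | 2 => τ.l2
  | 3 => τ.l3
  | 4 => τ.l4
  | _ => 0

/-- Cut flag of the block with label `k`. -/
def cflag : ℕ → Bool
  | 0 => τ.c0
  | 1 => τ.c1
  | 2 => τ.c2
  | 3 => τ.c3
  | _ => false

/-- Relay `x` is CUT (its block is not attached to the hub). -/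
def cut (x : ℕ) : Bool := τ.cflag (τ.lab x)

/-- Relay `x` is ATTACHED to the hub. -/
def att (x : ℕ) : Bool := !τ.cut x

/-- `y` lies in the `π`-block `B(x)` of `x` (relays `x, y`). -/
def inBlk (x y : ℕ) : Bool := τ.lab x == τ.lab y

/-- Size of the `π`-block of relay `x`. -/
def blkSize (x : ℕ) : ℕ := ([1, 2, 3, 4].filter fun y => τ.inBlk x y).length

/-- Points `s, t ∈ {0,…,4}` lie in the same part of the five-point partition `σ` (`{hub} ∪ attached blocks`, and each cut
block a part of its own). -/
def conn (s t : ℕ) : Bool :=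
  if s = t then true
  else if s = 0 then τ.att t
  else if t = 0 then τ.att s
  else (τ.att s && τ.att t) || τ.inBlk s t

/-- `s` and `t` are SEPARATED in `σ`. -/
def sep (s t : ℕ) : Bool := !τ.conn s t

/-- Number of cut relays `N`. -/
def ncut : ℕ := (τ.cut 1).toNat + (τ.cut 2).toNat + (τ.cut 3).toNat + (τ.cut 4).toNat

/-- Number of attached relays. -/
def natt : ℕ := (τ.att 1).toNat + (τ.att 2).toNat + (τ.att 3).toNat + (τ.att 4).toNat

/-- The inert types (all four relays attached): they carry no objective and no row content. -/
def inert : Bool := τ.natt == 4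

/-! ### Functionals (integrands), as integers -/

/-- Indicator as an integer. -/
def ind (b : Bool) : ℤ := if b then 1 else 0

/-- `cut_x` as an integer. -/
def cutZ (x : ℕ) : ℤ := ind (τ.cut x)

/-- `f = 1[N ≥ 3]` (at least three relays cut). -/
def fZ : ℤ := ind (decide (3 ≤ τ.ncut))

/-- THE OBJECTIVE INTEGRAND `e = f − cut₁` (`E f/δ₁ − 1 = Σ_τ e(τ)x_τ` for a scale-free law). -/
def eZ : ℤ := τ.fZ - τ.cutZ 1

/-- Budget row integrand `B_x = cut_x − cut₁` (`x = 2,3,4`; the row is `Σ B_x·x ≤ 0`, i.e. `δ_x ≤ δ₁`). -/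
def bud (x : ℕ) : ℤ := τ.cutZ x - τ.cutZ 1

/-- The two relays of `{2,3,4}` other than `x`. -/
def oth : ℕ → ℕ × ℕ
  | 2 => (3, 4)
  | 3 => (2, 4)
  | _ => (2, 3)

/-- vdBHK row `Calone_x = (cut_x − cut₁)·1[B(1) = {v₁}]`. -/
def calone (x : ℕ) : ℤ := if τ.blkSize 1 == 1 then τ.bud x else 0

/-- vdBHK row `Cnotfull_x = (cut_x − cut₁)·1[x ∉ B(1), ¬({y,z} ⊆ B(1))]`. -/
def cnotfull (x : ℕ) : ℤ :=
  if !τ.inBlk 1 x && !(τ.inBlk 1 (oth x).1 && τ.inBlk 1 (oth x).2) then τ.bud x else 0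

/-- vdBHK row `CaloneY_x_y = (cut_x − cut₁)·1[x ∉ B(1), z ∉ B(1)]` (`z` the third relay of `{2,3,4}`). -/
def caloneY (x y : ℕ) : ℤ := if !τ.inBlk 1 x && !τ.inBlk 1 (9 - x - y) then τ.bud x else 0

/-- vdBHK row `Cnotalone_x = (cut_x − cut₁)·1[1 ∉ B(x), |B(x)| ≥ 2]`. -/
def cnotalone (x : ℕ) : ℤ := if !τ.inBlk x 1 && !(τ.blkSize x == 1) then τ.bud x else 0

/-- vdBHK row `Cpair_xy = (cut_x − cut₁)·1[y ∈ B(x), 1 ∉ B(x)]` (`(x,y) ∈ {(2,3),(2,4),(3,4)}`). -/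
def cpair (x y : ℕ) : ℤ := if τ.inBlk x y && !τ.inBlk x 1 then τ.bud x else 0

/-- vdBHK row `Ctriple = (cut₂ − cut₁)·1[π = 1|234]`. -/
def ctriple : ℤ := if !τ.inBlk 1 2 && τ.inBlk 2 3 && τ.inBlk 2 4 then τ.bud 2 else 0

/-- Order-row integrand `cut_y − cut_x` for the WLOG order `δ_x ≥ δ_y` (`(x,y) ∈ {(2,3),(2,4),(3,4)}`). -/
def od (x y : ℕ) : ℤ := τ.cutZ y - τ.cutZ x

/-- Order row `O_alone_xy = (cut_y − cut_x)·1[B(x) = {x}]`. -/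
def oalone (x y : ℕ) : ℤ := if τ.blkSize x == 1 then τ.od x y else 0

/-- Order row `O_dn z_xy = (cut_y − cut_x)·1[y ∉ B(x), z ∉ B(x)]`. -/
def odn (z x y : ℕ) : ℤ := if !τ.inBlk x y && !τ.inBlk x z then τ.od x y else 0

/-- Order row `O_up z_xy = (cut_y − cut_x)·1[x ∉ B(y), z ∈ B(y)]`. -/
def oup (z x y : ℕ) : ℤ := if !τ.inBlk y x && τ.inBlk y z then τ.od x y else 0

/-- The two relays other than `x, y` (for `(x,y) ∈ {(2,3),(2,4),(3,4)}`; includes `v₁`). -/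
def rest : ℕ → ℕ → ℕ × ℕ
  | 2, 3 => (1, 4)
  | 2, 4 => (1, 3)
  | _, _ => (1, 2)

/-- Order row `O_dnboth_xy = (cut_y − cut_x)·1[y ∉ B(x), ¬({z,w} ⊆ B(x))]`. -/
def odnboth (x y : ℕ) : ℤ :=
  if !τ.inBlk x y && !(τ.inBlk x (rest x y).1 && τ.inBlk x (rest x y).2) then τ.od x y else 0

/-- Order row `O_upany_xy = (cut_y − cut_x)·1[x ∉ B(y), B(y) ∩ {z,w} ≠ ∅]`. -/
def oupany (x y : ℕ) : ℤ :=
  if !τ.inBlk y x && (τ.inBlk y (rest x y).1 || τ.inBlk y (rest x y).2) then τ.od x y else 0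

/-- Order row `O_upboth_xy = (cut_y − cut_x)·1[x ∉ B(y), {z,w} ⊆ B(y)]`. -/
def oupboth (x y : ℕ) : ℤ :=
  if !τ.inBlk y x && τ.inBlk y (rest x y).1 && τ.inBlk y (rest x y).2 then τ.od x y else 0

/-- All points of the list are pairwise separated in `σ`. -/
def pwSep : List ℕ → Bool
  | [] => true
  | s :: l => (l.all fun t => τ.sep s t) && pwSep l

/-- Isolation indicator `u_S = 1[S pairwise separated in σ]` (`S ⊆ {0,…,4}` as a list). -/
def uB (S : List ℕ) : Bool := τ.pwSep S

/-- `u_S` as an integer. -/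
def uZ (S : List ℕ) : ℤ := ind (τ.uB S)

/-- Support indicator `ρ_t^S = 1[the σ-part of t contains no other point of S]`. -/
def rho (S : List ℕ) (t : ℕ) : Bool := S.all fun s => s == t || τ.sep t s

/-! ### Events -/

/-- Layer event `T_z`: `v_z` is the ONLY attached relay. -/
def isT (z : ℕ) : Bool := τ.natt == 1 && τ.att z

/-- Layer event `S_z`: `{v_z}` is a singleton cut block. -/
def isS (z : ℕ) : Bool := τ.cut z && τ.blkSize z == 1

/-- All four relays cut. -/
def allCut : Bool := τ.natt == 0

/-- Hub-pair event `C_{wv}`: `v_w, v_v` attached, the other two relays cut. -/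
def isC (w v : ℕ) : Bool := τ.natt == 2 && τ.att w && τ.att v

/-- Glued-pair event `P_{wv}`: `{v_w, v_v}` is a cut block. -/
def isP (w v : ℕ) : Bool := τ.cut w && τ.inBlk w v && τ.blkSize w == 2

/-- The two relays other than `w, v` (any two distinct relays). -/
def compl (w v : ℕ) : ℕ × ℕ :=
  let l := [1, 2, 3, 4].filter fun z => !(z == w) && !(z == v)
  (l.headD 0, (l.drop 1).headD 0)

/-- `G_{wv}`: `v_w ~ v_v` in `σ`, separated from the other two relays. -/
def isG (w v : ℕ) : Bool := τ.conn w v && τ.sep w (compl w v).1 && τ.sep w (compl w v).2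

/-- Relay-root pair row `j = (root r, pair {x,y})` of van den Berg–Kahn type: event `A_j` = `v_r` separated from `v_x`
and `v_y`. -/
def isA (r x y : ℕ) : Bool := τ.sep r x && τ.sep r y

/-- Event `B_j = T_r`. -/
def isBj (r : ℕ) : Bool := τ.isT r

/-- Event `C_j`: `v_r` attached, `v_x, v_y` cut. -/
def isCj (r x y : ℕ) : Bool := τ.att r && τ.cut x && τ.cut y

/-- Event `D_j`: `v_r` separated from the three other relays. -/
def isD (r : ℕ) : Bool := [1, 2, 3, 4].all fun z => z == r || τ.sep r z

end DType

/-! ### Certificates and laws -/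

/-- A linear combination of integer functionals with integer coefficients — the shape of an (integer-scaled) REDUCED
COST `rc = d·e − Σ_k (dλ_k)·feat_k − Σ_S (dκ_S)·u_S + Σ_g ((dα_g)·1[C_g] − (dβ_g)·1[P_g])` of a clean certificate. -/
def combo (L : List (ℤ × (DType → ℤ))) (τ : DType) : ℤ := (L.map fun p => p.1 * p.2 τ).sum

/-- Number of types of the table on which an integer functional vanishes. -/
def zeroCount (φ : DType → ℤ) : ℕ := (allTypes.filter fun τ => φ τ == 0).length

noncomputable section

/-- The linear functional `Σ_τ φ(τ)·x_τ` of a LAW `x : DType → ℝ` (masses on the types; sum over the table). -/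
def lin (φ : DType → ℤ) (x : DType → ℝ) : ℝ := (allTypes.map fun τ => (φ τ : ℝ) * x τ).sum

/-- `E(x) = Σ_τ e(τ)x_τ` — for a scale-free law (`Σ_{cut₁} x = 1`) this is `E f/δ₁ − 1`. -/
abbrev E (x : DType → ℝ) : ℝ := lin DType.eZ x

/-- Isolation mass `u_S(x)`. -/
abbrev uS (S : List ℕ) (x : DType → ℝ) : ℝ := lin (fun τ => τ.uZ S) x

/-- Layer mass `T_z(x) = x(v_z is the only attached relay)`. -/
abbrev Tm (z : ℕ) (x : DType → ℝ) : ℝ := lin (fun τ => DType.ind (τ.isT z)) x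

/-- Layer mass `S_z(x) = x({v_z} is a singleton cut block)`. -/
abbrev Sm (z : ℕ) (x : DType → ℝ) : ℝ := lin (fun τ => DType.ind (τ.isS z)) x

/-- Hub-pair mass `x(C_{wv})`. -/
abbrev Cm (w v : ℕ) (x : DType → ℝ) : ℝ := lin (fun τ => DType.ind (τ.isC w v)) x

/-- Glued-pair mass `x(P_{wv})`. -/
abbrev Pm (w v : ℕ) (x : DType → ℝ) : ℝ := lin (fun τ => DType.ind (τ.isP w v)) x

/-- `x(all four relays cut)`. -/
abbrev ACm (x : DType → ℝ) : ℝ := lin (fun τ => DType.ind τ.allCut) x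

end

end TypeTable
end HubOnly

end Summit.CriticalPhenomena.PercolationContinuityZ3.Theorems
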